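import Literature.NumberTheory.GaloisRepresentations.PowerSeriesTopNilpotentIntertwine
import HarnessLib

/-!
# Elementary division by `T − b` through the `(p)`-adic evaluation, over ANY `(p)`-adically complete ring: `f(b) = f₀ + b·(shift f)(b)`,
# `f = (T − b)·q + f(b)` with `q_i = (tail_{i+1} f)(b)`, `(T − b) ∣ f ↔ f(b) = 0`, `T − b` is a non-zero-divisor, and the height-two division step

Washington, *Introduction to Cyclotomic Fields* (1997), §7.1 (division by a distinguished polynomial; here the linear case `T − b`, `b ∈ (p)`, done by
the telescoping identity `f(T) − f(b) = (T − b)·Σ_i (Σ_{j} f_{i+j+1} b^j) T^i`, whose inner sums are `(p)`-adic limits); de Shalit, *Iwasawa theory of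
elliptic curves with complex multiplication* (1987), II §4.12 (29)–(32) (division of the cocycle `μ_𝔞(σ_𝔠 − N𝔠) = μ_𝔠(σ_𝔞 − N𝔞)` by `σ_{𝔞₁} − N𝔞₁`).
`PowerSeriesTopNilpotentEvalDivision` proved these over a complete LOCAL DOMAIN via Mathlib's Weierstrass division; THIS file removes those hypotheses
(any commutative `A` with `IsAdicComplete (p) A`, `b ∈ (p)`), which is what the TWO-VARIABLE base `S = 𝒪_F⟦X⟧` of the Coleman lane needs.
Everything PROVED (0 sorry, no definitions):

* §1 `tailSeries`-free recursion ★ `tEval_eq_coeff_add_mul_tEval_tail` — **`(tail_i f)(b) = f_i + b·(tail_{i+1} f)(b)`** (`tail_i f = Σ_j f_{i+j} T^j`), in particular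
  `tEval_eq_constantCoeff_add_mul_tEval_shift` (`f(b) = f(0) + b·(shift f)(b)`);
* §2 ★★ **`exists_eq_X_sub_C_mul_add_C_tEval`** — `f = (T − b)·q + C(f(b))` with the explicit `q = Σ_i (tail_{i+1} f)(b)·T^i`; ★ `X_sub_C_dvd_of_tEval_eq_zero`
  (**`f(b) = 0 ⟹ (T − b) ∣ f`**), `mem_span_X_sub_C_iff_tEval_eq_zero` (`f ∈ (T − b) ↔ f(b) = 0`), ★ `X_sub_C_mem_nonZeroDivisors` (**`T − b` is a non-zero-divisor**:
  `(T − b)g = 0 ⟹ g_n ∈ ⋂_k (b^k) = 0`), `mem_nonZeroDivisors_of_eq_unit_mul_X_sub_C'`;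
* §3 ★★ `X_sub_C_dvd_of_mul_eq_mul'` / **`exists_eq_mul_of_mul_eq_mul'`** — if `d₂·y₁ = (w·(T − b))·y₂` with `d₂(b)` a non-zero-divisor of `A` then
  `y₁ = (w·(T − b))·L`: the height-two division step, hypothesis-free version.

## References
* L. C. Washington, *Introduction to Cyclotomic Fields*, 2nd ed. (1997), §7.1 Prop. 7.2. [Washington1997]
* E. de Shalit, *Iwasawa theory of elliptic curves with complex multiplication* (1987), Ch. II §4.12 (29)–(32). [deShalit1987]
-/

noncomputable section

namespace Literature.NumberTheory.GaloisRepresentations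

namespace LubinTate

open PowerSeries

variable {A : Type*} [CommRing A] {p : A} [IsAdicComplete (Ideal.span {p}) A] {b : A} (hb : b ∈ Ideal.span {p})

/-! ### §1. The evaluation recursion along the tails -/

/-- ★ **`(tail_i f)(b) = f_i + b · (tail_{i+1} f)(b)`**, `tail_i f = Σ_j f_{i+j} T^j` (`tail_i f = C f_i + T · tail_{i+1} f` and `tEval` is a ring
homomorphism with `tEval T = b`). [cite: Washington1997, §7.1] -/
theorem tEval_eq_coeff_add_mul_tEval_tail (f : PowerSeries A) (i : ℕ) :
    tEval hb (PowerSeries.mk fun j => PowerSeries.coeff (i + j) f) =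
      PowerSeries.coeff i f + b * tEval hb (PowerSeries.mk fun j => PowerSeries.coeff (i + 1 + j) f) := by
  have hsplit : (PowerSeries.mk fun j => PowerSeries.coeff (i + j) f) =
      PowerSeries.X * (PowerSeries.mk fun j => PowerSeries.coeff (i + 1 + j) f) + PowerSeries.C (PowerSeries.coeff i f) := by
    have h := PowerSeries.eq_X_mul_shift_add_const (PowerSeries.mk fun j => PowerSeries.coeff (i + j) f)
    have e : (PowerSeries.mk fun q => PowerSeries.coeff (q + 1) (PowerSeries.mk fun j => PowerSeries.coeff (i + j) f)) =
        PowerSeries.mk fun j => PowerSeries.coeff (i + 1 + j) f := by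
      ext q
      rw [PowerSeries.coeff_mk, PowerSeries.coeff_mk, PowerSeries.coeff_mk, show i + (q + 1) = i + 1 + q by omega]
    rw [e, PowerSeries.constantCoeff_mk, Nat.add_zero] at h
    exact h
  conv_lhs => rw [hsplit]
  rw [← tEvalHom_apply, map_add, map_mul, tEvalHom_apply, tEvalHom_apply, tEvalHom_apply, tEval_X, tEval_C, add_comm]

/-- **`f(b) = f(0) + b·(shift f)(b)`**, `shift f = Σ_j f_{j+1} T^j`. [cite: Washington1997, §7.1] -/
theorem tEval_eq_constantCoeff_add_mul_tEval_shift (f : PowerSeries A) :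
    tEval hb f = PowerSeries.constantCoeff f + b * tEval hb (PowerSeries.mk fun j => PowerSeries.coeff (j + 1) f) := by
  have h := tEval_eq_coeff_add_mul_tEval_tail hb f 0
  have e0 : (PowerSeries.mk fun j => PowerSeries.coeff (0 + j) f) = f := by
    ext j; rw [PowerSeries.coeff_mk, Nat.zero_add]
  have e1 : (PowerSeries.mk fun j => PowerSeries.coeff (0 + 1 + j) f) = PowerSeries.mk fun j => PowerSeries.coeff (j + 1) f := by
    ext j; rw [PowerSeries.coeff_mk, PowerSeries.coeff_mk, show 0 + 1 + j = j + 1 by omega]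
  rw [e0, e1, PowerSeries.coeff_zero_eq_constantCoeff] at h
  exact h

/-! ### §2. `f = (T − b)·q + C(f(b))`; `(T − b) ∣ f ↔ f(b) = 0`; `T − b` is a non-zero-divisor -/

/-- ★★ **`f = (T − b)·q + C(f(b))`** with the EXPLICIT quotient `q = Σ_i (tail_{i+1} f)(b)·T^i` (telescoping `f(T) − f(b) = (T − b)·q`); no locality,
no Weierstrass theory — only `(p)`-adic completeness. [cite: Washington1997, §7.1 Prop. 7.2] -/
theorem exists_eq_X_sub_C_mul_add_C_tEval (f : PowerSeries A) :
    ∃ q : PowerSeries A, f = (PowerSeries.X - PowerSeries.C b) * q + PowerSeries.C (tEval hb f) := by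
  refine ⟨PowerSeries.mk fun i => tEval hb (PowerSeries.mk fun j => PowerSeries.coeff (i + 1 + j) f), PowerSeries.ext fun n => ?_⟩
  rw [map_add, sub_mul, map_sub, PowerSeries.coeff_C_mul, PowerSeries.coeff_mk, PowerSeries.coeff_C]
  rcases n with _ | m
  · have e1 : (PowerSeries.mk fun j => PowerSeries.coeff (0 + 1 + j) f) = PowerSeries.mk fun j => PowerSeries.coeff (j + 1) f := by
      ext j; rw [PowerSeries.coeff_mk, PowerSeries.coeff_mk, show 0 + 1 + j = j + 1 by omega]
    rw [PowerSeries.coeff_zero_X_mul, if_pos rfl, e1, PowerSeries.coeff_zero_eq_constantCoeff, tEval_eq_constantCoeff_add_mul_tEval_shift hb f]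
    ring
  · rw [PowerSeries.coeff_succ_X_mul, PowerSeries.coeff_mk, if_neg (Nat.succ_ne_zero m), tEval_eq_coeff_add_mul_tEval_tail hb f (m + 1)]
    ring

/-- ★ **`f(b) = 0 ⟹ (T − b) ∣ f`** over any `(p)`-adically complete ring (the converse is `tEval_mul_X_sub_C`; the `iff` over a complete local
domain is `X_sub_C_dvd_iff_tEval_eq_zero` of `PowerSeriesTopNilpotentEvalDivision`). [cite: Washington1997, §7.1 Prop. 7.2] -/
theorem X_sub_C_dvd_of_tEval_eq_zero {f : PowerSeries A} (h0 : tEval hb f = 0) : (PowerSeries.X - PowerSeries.C b) ∣ f := by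
  obtain ⟨q, hq⟩ := exists_eq_X_sub_C_mul_add_C_tEval hb f
  refine ⟨q, ?_⟩
  rw [h0, map_zero, add_zero] at hq
  exact hq

/-- **`f ∈ (T − b) ↔ f(b) = 0`** (membership form of `ker tEval_b = (T − b)`, any `(p)`-adically complete ring). [cite: Washington1997, §7.1 Prop. 7.2] -/
theorem mem_span_X_sub_C_iff_tEval_eq_zero (f : PowerSeries A) :
    f ∈ Ideal.span {(PowerSeries.X - PowerSeries.C b : PowerSeries A)} ↔ tEval hb f = 0 := by
  rw [Ideal.mem_span_singleton]
  constructor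
  · rintro ⟨q, rfl⟩
    rw [mul_comm, tEval_mul_X_sub_C]
  · exact X_sub_C_dvd_of_tEval_eq_zero hb

/-- ★ **`T − b` is a non-zero-divisor of `A⟦T⟧`** for `b ∈ (p)`, `A` `(p)`-adically separated: `(T − b)·g = 0` forces `g_n = b·g_{n+1}`, so
`g_n ∈ ⋂_k (b^k) ⊆ ⋂_k (p^k) = 0`. [cite: Washington1997, §7.1] -/
theorem X_sub_C_mem_nonZeroDivisors (hb : b ∈ Ideal.span {p}) : (PowerSeries.X - PowerSeries.C b : PowerSeries A) ∈ nonZeroDivisors (PowerSeries A) := by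
  refine mem_nonZeroDivisors_iff_left.mpr fun g hg => ?_
  -- `g_n = b · g_{n+1}` for all `n`
  have hrec : ∀ n, PowerSeries.coeff n g = b * PowerSeries.coeff (n + 1) g := by
    intro n
    have h := congrArg (PowerSeries.coeff (n + 1)) hg
    rw [sub_mul, map_sub, PowerSeries.coeff_succ_X_mul, PowerSeries.coeff_C_mul, map_zero, sub_eq_zero] at h
    exact h
  -- hence `g_n = b^k · g_{n+k}`
  have hpow : ∀ k n, PowerSeries.coeff n g = b ^ k * PowerSeries.coeff (n + k) g := by
    intro k
    induction k with
    | zero => intro n; rw [pow_zero, one_mul, Nat.add_zero]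
    | succ k ih => intro n; rw [ih n, hrec (n + k), ← mul_assoc, ← pow_succ, add_assoc]
  ext n
  rw [map_zero]
  refine IsHausdorff.haus' (I := Ideal.span {p}) _ fun k => ?_
  have hbk : b ^ k ∈ Ideal.span {p ^ k} := by
    have h := Ideal.pow_mem_pow hb k
    rwa [Ideal.span_singleton_pow] at h
  rw [SModEq.sub_mem, sub_zero, smul_eq_mul, Ideal.mul_top, Ideal.span_singleton_pow, hpow k n]
  exact Ideal.mul_mem_right _ _ hbk

include hb in
/-- `w·(T − b)` is a non-zero-divisor for a unit `w`. [cite: deShalit1987, Ch. II §4.12 (32)] -/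
theorem mem_nonZeroDivisors_of_eq_unit_mul_X_sub_C' {d₁ w : PowerSeries A} (hw : IsUnit w)
    (hd₁ : d₁ = w * (PowerSeries.X - PowerSeries.C b)) : d₁ ∈ nonZeroDivisors (PowerSeries A) := by
  rw [hd₁]
  exact mul_mem (IsUnit.mem_nonZeroDivisors hw) (X_sub_C_mem_nonZeroDivisors hb)

/-! ### §3. The height-two division step, hypothesis-free form -/

/-- ★★ **If `d₂·y₁ = (w·(T − b))·y₂` and `d₂(b)` is a non-zero-divisor of `A`, then `(T − b) ∣ y₁`.** [cite: deShalit1987, Ch. II §4.12 (29)–(32)] -/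
theorem X_sub_C_dvd_of_mul_eq_mul' {d₂ y₁ y₂ w : PowerSeries A}
    (h : d₂ * y₁ = w * (PowerSeries.X - PowerSeries.C b) * y₂) (hd₂ : tEval hb d₂ ∈ nonZeroDivisors A) :
    (PowerSeries.X - PowerSeries.C b) ∣ y₁ := by
  have hev := congrArg (tEval hb) h
  rw [tEval_mul, tEval_mul, tEval_mul_X_sub_C, zero_mul] at hev
  exact X_sub_C_dvd_of_tEval_eq_zero hb (mem_nonZeroDivisors_iff_left.mp hd₂ _ hev)

/-- ★★ **DIVISION STEP** (hypothesis-free form): if `d₂·y₁ = d₁·y₂` with `d₁ = w·(T − b)`, `w` a unit, `d₂(b)` a non-zero-divisor of `A`, then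
**`y₁ = d₁·L` for some `L ∈ A⟦T⟧`**. [cite: deShalit1987, Ch. II §4.12 (29)–(32)] -/
theorem exists_eq_mul_of_mul_eq_mul' {d₁ d₂ y₁ y₂ w : PowerSeries A} (hw : IsUnit w)
    (hd₁ : d₁ = w * (PowerSeries.X - PowerSeries.C b)) (h : d₂ * y₁ = d₁ * y₂) (hd₂ : tEval hb d₂ ∈ nonZeroDivisors A) :
    ∃ L : PowerSeries A, y₁ = d₁ * L := by
  rw [hd₁] at h
  obtain ⟨q, hq⟩ := X_sub_C_dvd_of_mul_eq_mul' hb h hd₂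
  refine ⟨↑hw.unit⁻¹ * q, ?_⟩
  rw [hd₁, hq, mul_assoc, mul_left_comm (PowerSeries.X - PowerSeries.C b), ← mul_assoc, IsUnit.mul_val_inv, one_mul]

end LubinTate

end Literature.NumberTheory.GaloisRepresentations
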